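import Mathlib.Probability.ProbabilityMassFunction.Constructions
import Mathlib.Probability.Distributions.Uniform
import Mathlib.Data.Matrix.Mul
import Literature.Computability.Cryptography.Indistinguishability
import HarnessLib

/-!
# Sparse LPN / noisy `k`-XOR: the planted and null ensembles, and Alekhnovich's hypothesis

Trunk T-CRYPTO (Literature/Computability/Cryptography); definition request `wi-03696`
(`sparseLPN`, route PneNP/Feige).

* `weightRows k n` — the vectors in `(ℤ/2)ⁿ` of Hamming weight exactly `k` (rows of a `k`-sparse
  matrix; `C(n,k)` of them).
* `iidPMF μ ι` — the product law `μ^{⊗ι}` on `ι → α` for finite `ι`, `α` (honest `PMF.ofFintype`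
  with `∏ᵢ μ(fᵢ)`); `bernoulliBit η : PMF (ZMod 2)` — `1` with probability `η` (clamped to
  `[0,1]`).
* `sparseLPN k n m η : PMF (Matrix (Fin m) (Fin n) (ZMod 2) × (Fin m → ZMod 2))` — the PLANTED
  ensemble: rows of `A` i.i.d. uniform of weight exactly `k`, secret `x` uniform on `(ℤ/2)ⁿ`,
  noise `e ∼ Ber(η)^{⊗m}`, output `(A, Ax + e)`; `sparseLPNNull k n m` — the NULL ensemble
  `(A, u)` with `u` uniform on `(ℤ/2)ᵐ`. Junk (`n < k`, no weight-`k` row): point mass at `(0,0)`.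
* `encodeLPN (A, b) : List Bool` (row-major bits of `A`, then `b`), the ensembles
  `sparseLPNEnsemble k Δ η`, `sparseLPNNullEnsemble k Δ : Ensemble (List Bool)` at `m = ⌈Δn⌉`, and
  `AlekhnovichHypothesis Δ η := IsCompIndistinguishable (planted, k = 3) (null, k = 3)`
  (the tree's PPT indistinguishability, `Indistinguishability.lean`).

## Sources and faithfulness

* M. Alekhnovich, *More on average case vs approximation complexity*, FOCS 2003
  (Comput. Complexity 20 (2011) 755–786), §2, Conjecture 1: pseudorandomness of noisy sparse
  linear systems `(A, Ax + e)` with `A` a random `m × n` matrix with 3 ones per row, `m = O(n)`.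
  Alekhnovich's noise model there is a uniformly random error vector of prescribed weight; the
  i.i.d. `Ber(η)` model used here is the requester's rendering (`wi-03696`) and the standard
  "sparse LPN" form (Applebaum–Barak–Wigderson 2010, §1; Allen–O'Donnell–Witmer 2015, §1
  (noisy 3-XOR)). `AlekhnovichHypothesis` is a `Prop` DEFINITION (nothing is asserted); routes
  taking it as a hypothesis should cite it as "sparse-LPN indistinguishability in the sense of
  Alekhnovich 2003, Conj. 1 (Bernoulli-noise form)".
* O. Goldreich, *Foundations of Cryptography I* (2001), Def. 3.2.2 (computational
  indistinguishability — the tree's `IsCompIndistinguishable`).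
-/

noncomputable section

open scoped Classical
open Matrix

namespace Literature.Computability.Cryptography

/-! ### Product laws and Bernoulli bits -/

/-- The i.i.d. product law `μ^{⊗ι}` on functions `ι → α` (`ι`, `α` finite):
`P(f) = ∏ᵢ μ(f i)`. [Goldreich 2001, §1.2 (product distributions)] [folklore] -/
def iidPMF {α ι : Type*} [Fintype α] [Fintype ι] (μ : PMF α) : PMF (ι → α) :=
  PMF.ofFintype (fun f => ∏ i, μ (f i)) (by
    rw [← Fintype.piFinset_univ, ← Finset.prod_univ_sum (fun _ => Finset.univ) fun _ a => μ a]
    have h1 : ∑ a, μ a = 1 := by rw [← tsum_fintype (L := SummationFilter.unconditional _)]; exact μ.tsum_coe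
    simp [h1])

/-- The probability of a function under the product law. [folklore] -/
@[simp] theorem iidPMF_apply {α ι : Type*} [Fintype α] [Fintype ι] (μ : PMF α) (f : ι → α) :
    iidPMF μ f = ∏ i, μ (f i) :=
  PMF.ofFintype_apply _ _

/-- The noise parameter clamped to `[0, 1]` as an `ℝ≥0`. [folklore] -/
def clampProb (η : ℝ) : NNReal := min 1 (Real.toNNReal η)

/-- `clampProb η ≤ 1`. [folklore] -/
theorem clampProb_le_one (η : ℝ) : clampProb η ≤ 1 := min_le_left _ _

/-- A Bernoulli bit in `ℤ/2`: `1` with probability `η` (clamped to `[0,1]`), else `0`.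
[Alekhnovich 2003, §2 (noise); Applebaum–Barak–Wigderson 2010, §1] [folklore] -/
def bernoulliBit (η : ℝ) : PMF (ZMod 2) :=
  PMF.ofFintype (fun b => if b = 1 then (clampProb η : ENNReal) else 1 - clampProb η) (by
    change (∑ a : Fin 2, if a = 1 then (clampProb η : ENNReal) else 1 - clampProb η) = 1
    rw [Fin.sum_univ_two]
    simp only [Fin.isValue, zero_ne_one, ↓reduceIte]
    exact tsub_add_cancel_of_le (by exact_mod_cast clampProb_le_one η))

/-! ### Sparse matrices -/

/-- The vectors of `(ℤ/2)ⁿ` of Hamming weight exactly `k` (supports of size `k`).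
[Alekhnovich 2003, §2 (matrices with exactly 3 ones per row)] [folklore] -/
def weightRows (k n : ℕ) : Finset (Fin n → ZMod 2) :=
  Finset.univ.filter fun r => (Finset.univ.filter fun j => r j ≠ 0).card = k

/-- The uniform law on `m`-tuples of weight-`k` rows, as an `m × n` matrix over `ℤ/2` (rows
i.i.d. uniform of weight exactly `k`); requires a weight-`k` row to exist (`k ≤ n`).
[Alekhnovich 2003, §2] [folklore] -/
def sparseMatrixPMF (k n m : ℕ) (h : (weightRows k n).Nonempty) :
    PMF (Matrix (Fin m) (Fin n) (ZMod 2)) :=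
  haveI : Nonempty ↥(weightRows k n) := h.coe_sort
  (PMF.uniformOfFintype (Fin m → ↥(weightRows k n))).map fun r => Matrix.of fun i j => (r i).1 j

/-! ### The planted and null ensembles -/

/-- **Sparse LPN / noisy `k`-XOR, planted distribution** on `(A, b)`: `A` with i.i.d. uniform
weight-`k` rows, `x` uniform on `(ℤ/2)ⁿ`, `e ∼ Ber(η)^{⊗m}` independent, `b = Ax + e`. Junk: the
point mass at `(0, 0)` when `n < k`. [Alekhnovich 2003, §2, Conj. 1 (with his noise model);
Applebaum–Barak–Wigderson 2010, §1 (sparse LPN)] [cite: Alekhnovich2003, §2 Conjecture 1] -/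
def sparseLPN (k n m : ℕ) (η : ℝ) : PMF (Matrix (Fin m) (Fin n) (ZMod 2) × (Fin m → ZMod 2)) :=
  if h : (weightRows k n).Nonempty then
    (sparseMatrixPMF k n m h).bind fun A =>
      (PMF.uniformOfFintype (Fin n → ZMod 2)).bind fun x =>
        (iidPMF (ι := Fin m) (bernoulliBit η)).map fun e => (A, A *ᵥ x + e)
  else PMF.pure (0, 0)

/-- **The null distribution** `(A, u)`: same `A`, `u` uniform on `(ℤ/2)ᵐ` independent of `A`.
Junk `(0,0)` when `n < k`. [Alekhnovich 2003, §2, Conj. 1] [cite: Alekhnovich2003, §2 Conjecture 1] -/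
def sparseLPNNull (k n m : ℕ) : PMF (Matrix (Fin m) (Fin n) (ZMod 2) × (Fin m → ZMod 2)) :=
  if h : (weightRows k n).Nonempty then
    (sparseMatrixPMF k n m h).bind fun A =>
      (PMF.uniformOfFintype (Fin m → ZMod 2)).map fun u => (A, u)
  else PMF.pure (0, 0)

/-- Bit-string encoding of an instance `(A, b)`: the `m·n` entries of `A` row by row, then the
`m` entries of `b` (`1 ↦ true`). [Goldreich 2001, §1.2 (encodings)] [folklore] -/
def encodeLPN {m n : ℕ} (I : Matrix (Fin m) (Fin n) (ZMod 2) × (Fin m → ZMod 2)) : List Bool :=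
  (List.ofFn fun i : Fin m => List.ofFn fun j : Fin n => decide (I.1 i j = 1)).flatten ++
    List.ofFn fun i : Fin m => decide (I.2 i = 1)

/-- The planted sparse-LPN ENSEMBLE at density `Δ` (`m = ⌈Δn⌉`) and noise `η`, on bit strings.
[Alekhnovich 2003, §2] [folklore] -/
def sparseLPNEnsemble (k : ℕ) (Δ η : ℝ) : Ensemble (List Bool) :=
  fun n => (sparseLPN k n ⌈Δ * n⌉₊ η).map encodeLPN

/-- The null sparse-LPN ensemble at density `Δ`. [Alekhnovich 2003, §2] [folklore] -/
def sparseLPNNullEnsemble (k : ℕ) (Δ : ℝ) : Ensemble (List Bool) :=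
  fun n => (sparseLPNNull k n ⌈Δ * n⌉₊).map encodeLPN

/-- **Alekhnovich's hypothesis (sparse-LPN / noisy 3-XOR indistinguishability), Bernoulli-noise
form, at density `Δ` and noise rate `η`**: the planted ensemble `(A, Ax + e)` (`A` with `⌈Δn⌉`
i.i.d. uniform rows of weight `3`, `x` uniform, `e ∼ Ber(η)^{⊗m}`) and the null ensemble
`(A, u)` are computationally indistinguishable for PPT distinguishers (the tree's
`IsCompIndistinguishable`, negligible advantage). Alekhnovich states Conjecture 1 for `m = O(n)`
with his own noise model (random error vector of prescribed weight); this is the i.i.d.-noise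
rendering requested by `wi-03696`. A `Prop` definition; nothing asserted; content only for
`0 < η < 1/2` and `Δ` large. [Alekhnovich 2003, §2, Conjecture 1; Applebaum–Barak–Wigderson 2010,
§1] [cite: Alekhnovich2003, §2 Conjecture 1] -/
def AlekhnovichHypothesis (Δ η : ℝ) : Prop :=
  IsCompIndistinguishable (sparseLPNEnsemble 3 Δ η) (sparseLPNNullEnsemble 3 Δ)

/-! ### API -/

/-- Weight-`k` rows exist iff `k ≤ n`. [folklore] -/
theorem weightRows_nonempty_iff (k n : ℕ) : (weightRows k n).Nonempty ↔ k ≤ n := by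
  constructor
  · rintro ⟨r, hr⟩
    rw [weightRows, Finset.mem_filter] at hr
    rw [← hr.2]
    exact (Finset.card_le_univ _).trans (by simp)
  · intro hk
    obtain ⟨S, -, hS⟩ := Finset.exists_subset_card_eq (s := (Finset.univ : Finset (Fin n)))
      (n := k) (by simpa using hk)
    refine ⟨fun j => if j ∈ S then 1 else 0, ?_⟩
    rw [weightRows, Finset.mem_filter]
    refine ⟨Finset.mem_univ _, ?_⟩
    rw [← hS]
    congr 1
    ext j
    by_cases h : j ∈ S <;> simp [h]

/-- The probability of the bit `1` is the (clamped) noise rate. [folklore] -/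
@[simp] theorem bernoulliBit_apply_one (η : ℝ) : bernoulliBit η 1 = clampProb η := by
  simp [bernoulliBit, PMF.ofFintype_apply]

/-- The probability of the bit `0` is `1 - η` (clamped). [folklore] -/
@[simp] theorem bernoulliBit_apply_zero (η : ℝ) : bernoulliBit η 0 = 1 - clampProb η := by
  simp [bernoulliBit, PMF.ofFintype_apply]

/-- The encoding of an `m × n` instance has length `m·n + m`. [folklore] -/
theorem length_encodeLPN {m n : ℕ} (I : Matrix (Fin m) (Fin n) (ZMod 2) × (Fin m → ZMod 2)) :
    (encodeLPN I).length = m * n + m := by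
  simp [encodeLPN, List.length_flatten, Function.comp_def]

/-- Alekhnovich's hypothesis is an instance of the tree's computational indistinguishability, so
it is symmetric in the two ensembles. [Goldreich 2001, Def. 3.2.2] [folklore] -/
theorem AlekhnovichHypothesis.symm {Δ η : ℝ} (h : AlekhnovichHypothesis Δ η) :
    IsCompIndistinguishable (sparseLPNNullEnsemble 3 Δ) (sparseLPNEnsemble 3 Δ η) :=
  IsCompIndistinguishable.symm h

end Literature.Computability.Cryptography
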